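import Mathlib
import Literature.NumberTheory.Transcendental.KZCalculusProofs
import Literature.NumberTheory.Transcendental.KZLogCalculusProofs
import Literature.NumberTheory.Transcendental.KZSemialgebraicComplex
import Literature.NumberTheory.Transcendental.SemialgebraicMapsProofs
import Literature.NumberTheory.Transcendental.EllIterRep
import Summits.KontsevichZagierPeriods.KontsevichZagierPeriods.Theorems.HermiteRigidityGenusTwoCycleTransferPushforwardDimOne

/-!
# `OffTetraSectorKernel`, line `odd-hyperbolic-ladder`: the Möbius base change of a band
(`stub_moebiusCovLift`)

Stub `stub_moebiusCovLift` of the crux `OffTetraSectorKernel` (stmt-KontsevichZagierPeriods-10557,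
route HyperbolicBloch). For real algebraic `a b c d lo hi` with `lo < hi`, `ad − bc ≠ 0` and
`c t + d > 0` on `[lo, hi]`, the Möbius map `m(t) = (a t + b)/(c t + d)` of the base variable is
continuous and strictly monotone on `[lo, hi]` (the sign of
`m(t) − m(s) = (ad − bc)(t − s)/((ct + d)(cs + d))` is the sign of `ad − bc`), hence injective
with image the open interval of endpoints `m(lo)`,
`m(hi)` (intermediate value theorem); it is a RATIONAL map with real algebraic coefficients, hence
`ℚ`-semialgebraic, and its derivative at `t` is `m′(t) = (ad − bc)/(ct + d)²`, i.e. the chart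
`Φ p = (fun _ => m (p 0))` of `ℝ¹` has derivative `m′(p 0) • id` of absolute determinant
`|ad − bc|/(c p₀ + d)²`. Feeding these one-variable data to the tree lemma
`KZ.of_sub_of_mem_relations_covLift` (the lift `Ψ(t, w) = (m t, w)` of a base change to the
unfolded-logarithm bands `{t ∈ σ, 1 ≤ w ≤ v t}`) gives ONE rule-(2) move
`[band over (lo, hi), f] − [band over m((lo, hi)), f'] ∈ KZ.relations` whenever
`f (t, w) = f' (m t, w) · |ad − bc|/(ct + d)²` on the source band and `v = v' ∘ m`.

The one-dimensional chart lemmas `hasFDerivAt_fin_one` (chain rule through `p ↦ p 0`) and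
`det_smul_id_fin_one` (`det (s • id_{ℝ¹}) = s`) are REUSED from
`HermiteRigidityGenusTwoCycleTransferPushforwardDimOne.lean`, the interval
`{lo < p 0 < hi}` is `ℚ`-semialgebraic by `KZ.isSemialgebraic_setOf_const_lt_apply` /
`KZ.isSemialgebraic_setOf_apply_lt_const` (`EllIterRep.lean`), and the semialgebraicity of the
chart (`moebiusCovLift_isSemialgebraicMapOn`) follows the AFFINE one-variable chart
`aff_isSemialgebraicMapOn_chart` of `TerasomaMultiplicationBetaCancellationStubAffineMove.lean`,
the affine map replaced by the Möbius map. No definitions are introduced.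

References: M. Kontsevich, D. Zagier, *Periods* (2001), §1.2 rule (2); J. Bochnak, M. Coste,
M.-F. Roy, *Real Algebraic Geometry* (1998), §2.2.
-/

noncomputable section

open Set MeasureTheory
open Literature.NumberTheory.Transcendental Literature.ModelTheory.ExponentialFields
open Summit.KontsevichZagierPeriods.HermiteRigidity.GenusTwoCycleTransfer
  (det_smul_id_fin_one hasFDerivAt_fin_one)

namespace Summit.KontsevichZagierPeriods.HyperbolicBloch.OffTetraSectorKernel

/-! ### The Möbius map `m(t) = (a t + b)/(c t + d)` of the line -/

/-- The difference formula `m(t) − m(s) = (ad − bc)(t − s)/((ct + d)(cs + d))`. [folklore] -/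
theorem moebiusCovLift_sub (a b c d s t : ℝ) (hs : c * s + d ≠ 0) (ht : c * t + d ≠ 0) :
    (a * t + b) / (c * t + d) - (a * s + b) / (c * s + d) =
      (a * d - b * c) * (t - s) / ((c * t + d) * (c * s + d)) := by
  rw [div_sub_div _ _ ht hs]
  congr 1
  ring

/-- A Möbius map with `ad − bc ≠ 0` is injective where its denominator does not vanish.
[folklore] -/
theorem moebiusCovLift_eq_of_eq {a b c d s t : ℝ} (hD : a * d - b * c ≠ 0) (hs : c * s + d ≠ 0)
    (ht : c * t + d ≠ 0) (h : (a * s + b) / (c * s + d) = (a * t + b) / (c * t + d)) : s = t := by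
  have h0 : (a * d - b * c) * (t - s) / ((c * t + d) * (c * s + d)) = 0 := by
    rw [← moebiusCovLift_sub a b c d s t hs ht, h, sub_self]
  rcases div_eq_zero_iff.mp h0 with h1 | h1
  · rcases mul_eq_zero.mp h1 with h2 | h2
    · exact absurd h2 hD
    · linarith [sub_eq_zero.mp h2]
  · exact absurd h1 (mul_ne_zero ht hs)

/-- For `ad − bc > 0` the Möbius map is increasing where its denominator is positive.
[folklore] -/
theorem moebiusCovLift_lt_of_pos {a b c d s t : ℝ} (hD : 0 < a * d - b * c) (hs : 0 < c * s + d)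
    (ht : 0 < c * t + d) (hst : s < t) :
    (a * s + b) / (c * s + d) < (a * t + b) / (c * t + d) := by
  rw [← sub_pos, moebiusCovLift_sub a b c d s t hs.ne' ht.ne']
  exact div_pos (mul_pos hD (sub_pos.2 hst)) (mul_pos ht hs)

/-- For `ad − bc < 0` the Möbius map is decreasing where its denominator is positive.
[folklore] -/
theorem moebiusCovLift_lt_of_neg {a b c d s t : ℝ} (hD : a * d - b * c < 0) (hs : 0 < c * s + d)
    (ht : 0 < c * t + d) (hst : s < t) :
    (a * t + b) / (c * t + d) < (a * s + b) / (c * s + d) := by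
  rw [← sub_neg, moebiusCovLift_sub a b c d s t hs.ne' ht.ne']
  exact div_neg_of_neg_of_pos (mul_neg_of_neg_of_pos hD (sub_pos.2 hst)) (mul_pos ht hs)

/-- The derivative of the Möbius map: `m′(t) = (ad − bc)/(ct + d)²`. [folklore] -/
theorem moebiusCovLift_hasDerivAt (a b c d t : ℝ) (ht : c * t + d ≠ 0) :
    HasDerivAt (fun t => (a * t + b) / (c * t + d)) ((a * d - b * c) / (c * t + d) ^ 2) t := by
  have h1 : HasDerivAt (fun t => a * t + b) a t := by
    simpa using ((hasDerivAt_id t).const_mul a).add_const b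
  have h2 : HasDerivAt (fun t => c * t + d) c t := by
    simpa using ((hasDerivAt_id t).const_mul c).add_const d
  refine (h1.div h2 ht).congr_deriv ?_
  ring

/-- The Möbius map is continuous on `[lo, hi]` when its denominator is positive there.
[folklore] -/
theorem moebiusCovLift_continuousOn {a b c d lo hi : ℝ} (hpos : ∀ t ∈ Icc lo hi, 0 < c * t + d) :
    ContinuousOn (fun t => (a * t + b) / (c * t + d)) (Icc lo hi) :=
  ContinuousOn.div (by fun_prop) (by fun_prop) fun t ht => (hpos t ht).ne'

/-! ### The chart `Φ p = (fun _ => m (p 0))` of `ℝ¹` -/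

/-- The Möbius chart is injective on any set where the denominator does not vanish.
[folklore] -/
theorem moebiusCovLift_injOn {a b c d : ℝ} (hD : a * d - b * c ≠ 0) {σ : Set (Fin 1 → ℝ)}
    (h0 : ∀ p ∈ σ, c * p 0 + d ≠ 0) :
    InjOn (fun y : Fin 1 → ℝ => fun _ : Fin 1 => (a * y 0 + b) / (c * y 0 + d)) σ := by
  intro x hx y hy hxy
  have h : (a * x 0 + b) / (c * x 0 + d) = (a * y 0 + b) / (c * y 0 + d) := congrFun hxy 0
  have h1 : x 0 = y 0 := moebiusCovLift_eq_of_eq hD (h0 x hx) (h0 y hy) h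
  funext i
  rw [Fin.fin_one_eq_zero i]
  exact h1

/-- The Möbius chart maps the interval `(lo, hi)` ONTO the open interval of endpoints `m(lo)`,
`m(hi)`: into it by strict monotonicity (sign of `ad − bc`), onto it by the intermediate value
theorem. [folklore] -/
theorem moebiusCovLift_image {a b c d lo hi : ℝ} (hlohi : lo < hi) (hD : a * d - b * c ≠ 0)
    (hpos : ∀ t ∈ Icc lo hi, 0 < c * t + d) :
    (fun y : Fin 1 → ℝ => fun _ : Fin 1 => (a * y 0 + b) / (c * y 0 + d)) ''
        {p : Fin 1 → ℝ | lo < p 0 ∧ p 0 < hi} =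
      {q : Fin 1 → ℝ | min ((a * lo + b) / (c * lo + d)) ((a * hi + b) / (c * hi + d)) < q 0 ∧
        q 0 < max ((a * lo + b) / (c * lo + d)) ((a * hi + b) / (c * hi + d))} := by
  have hl : 0 < c * lo + d := hpos lo (left_mem_Icc.2 hlohi.le)
  have hh : 0 < c * hi + d := hpos hi (right_mem_Icc.2 hlohi.le)
  ext q
  simp only [mem_image, mem_setOf_eq]
  constructor
  · rintro ⟨p, ⟨h1, h2⟩, rfl⟩
    have hp : 0 < c * p 0 + d := hpos (p 0) ⟨h1.le, h2.le⟩
    rcases lt_or_gt_of_ne hD with hneg | hpos'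
    · exact ⟨min_lt_iff.2 (Or.inr (moebiusCovLift_lt_of_neg hneg hp hh h2)),
        lt_max_iff.2 (Or.inl (moebiusCovLift_lt_of_neg hneg hl hp h1))⟩
    · exact ⟨min_lt_iff.2 (Or.inl (moebiusCovLift_lt_of_pos hpos' hl hp h1)),
        lt_max_iff.2 (Or.inr (moebiusCovLift_lt_of_pos hpos' hp hh h2))⟩
  · rintro ⟨h1, h2⟩
    have hq : q 0 ∈ (fun t => (a * t + b) / (c * t + d)) '' Ioo lo hi := by
      rcases le_total ((a * lo + b) / (c * lo + d)) ((a * hi + b) / (c * hi + d)) with hle | hle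
      · rw [min_eq_left hle] at h1
        rw [max_eq_right hle] at h2
        exact intermediate_value_Ioo hlohi.le (moebiusCovLift_continuousOn hpos) ⟨h1, h2⟩
      · rw [min_eq_right hle] at h1
        rw [max_eq_left hle] at h2
        exact intermediate_value_Ioo' hlohi.le (moebiusCovLift_continuousOn hpos) ⟨h1, h2⟩
    obtain ⟨t, ht, hqt⟩ := hq
    refine ⟨fun _ => t, ht, ?_⟩
    funext i
    rw [Fin.fin_one_eq_zero i]
    exact hqt

/-- The Möbius chart is a `ℚ`-semialgebraic map on any `ℚ`-semialgebraic set avoiding its pole: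
its single component `(a X₀ + b)/(c X₀ + d)` is a quotient of polynomials with REAL ALGEBRAIC
coefficients (`isSemialgebraicFunOn_const_of_isAlgebraic`, closure under `+`, `·`, `/`).
[cite: KontsevichZagier2001, §1.1] -/
theorem moebiusCovLift_isSemialgebraicMapOn {σ : Set (Fin 1 → ℝ)} (hσ : IsSemialgebraic ℚ σ)
    {a b c d : ℝ} (ha : IsAlgebraic ℚ a) (hb : IsAlgebraic ℚ b) (hc : IsAlgebraic ℚ c)
    (hd : IsAlgebraic ℚ d) (h0 : ∀ p ∈ σ, c * p 0 + d ≠ 0) :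
    IsSemialgebraicMapOn ℚ σ
      (fun y : Fin 1 → ℝ => fun _ : Fin 1 => (a * y 0 + b) / (c * y 0 + d)) := by
  -- adapted from `aff_isSemialgebraicMapOn_chart`
  -- (Theorems/TerasomaMultiplicationBetaCancellationStubAffineMove.lean)
  have hcoord : IsSemialgebraicFunOn ℚ σ (fun y : Fin 1 → ℝ => y 0) :=
    isSemialgebraicFunOn_apply hσ 0
  have hnum : IsSemialgebraicFunOn ℚ σ (fun y : Fin 1 → ℝ => a * y 0 + b) :=
    (IsSemialgebraicFunOn.add_holds
      (IsSemialgebraicFunOn.mul_holds (isSemialgebraicFunOn_const_of_isAlgebraic hσ ha) hcoord)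
      (isSemialgebraicFunOn_const_of_isAlgebraic hσ hb)).congr fun y _ => by
        simp only [Pi.add_apply, Pi.mul_apply]
  have hden : IsSemialgebraicFunOn ℚ σ (fun y : Fin 1 → ℝ => c * y 0 + d) :=
    (IsSemialgebraicFunOn.add_holds
      (IsSemialgebraicFunOn.mul_holds (isSemialgebraicFunOn_const_of_isAlgebraic hσ hc) hcoord)
      (isSemialgebraicFunOn_const_of_isAlgebraic hσ hd)).congr fun y _ => by
        simp only [Pi.add_apply, Pi.mul_apply]
  exact IsSemialgebraicMapOn.of_forall hσ fun _ => hnum.div hden h0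

/-! ### Coordinates of `ℝ²` as a band over `ℝ¹` -/

/-- `Fin.snoc (fun _ => u) w = ![u, w]`. [folklore] -/
theorem moebiusCovLift_snoc_eq (u w : ℝ) :
    (Fin.snoc (fun _ : Fin 1 => u) w : Fin 2 → ℝ) = ![u, w] := by
  funext i
  fin_cases i <;> rfl

/-! ### The stub -/

/-- **Registered stub `stub_moebiusCovLift`** (rule (2), ONE move — a Möbius change of the BASE
variable of a band): for real algebraic `a b c d lo hi` with `ad − bc ≠ 0` and `c t + d > 0` on
`[lo, hi]`, the map `Ψ(t, w) = ((a t + b)/(c t + d), w)` carries the band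
`{lo < t < hi, 1 ≤ w ≤ v(t)}` onto the band over the image interval (endpoints `m(lo)`, `m(hi)` in
either order, `m(t) = (at+b)/(ct+d)`) with fibre bound `v'`, `v = v' ∘ m`, and Jacobian
`|ad − bc|/(ct+d)²`; so two representations with these domains and `f = (f' ∘ Ψ) · Jacobian` differ
by an element of `KZ.relations`. Tree tool: `KZ.of_sub_of_mem_relations_covLift` fed with the
one-variable data (`moebiusCovLift_isSemialgebraicMapOn`, `hasFDerivAt_fin_one` +
`moebiusCovLift_hasDerivAt`, `moebiusCovLift_injOn`, `moebiusCovLift_image`).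
[cite: KontsevichZagier2001, §1.2 rule (2)] -/
theorem stub_moebiusCovLift :
    ∀ (a b c d lo hi : ℝ), IsAlgebraic ℚ a → IsAlgebraic ℚ b → IsAlgebraic ℚ c → IsAlgebraic ℚ d →
      IsAlgebraic ℚ lo → IsAlgebraic ℚ hi → lo < hi → a * d - b * c ≠ 0 →
      (∀ t ∈ Set.Icc lo hi, 0 < c * t + d) →
    ∀ (v v' : (Fin 1 → ℝ) → ℝ),
      (∀ p : Fin 1 → ℝ, lo < p 0 → p 0 < hi → v p = v' (fun _ => (a * p 0 + b) / (c * p 0 + d))) →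
    ∀ (r r' : KZ.IntegralRep 2),
      r.domain = {z | (lo < z 0 ∧ z 0 < hi) ∧ 1 ≤ z 1 ∧ z 1 ≤ v (fun _ => z 0)} →
      r'.domain = {z | (min ((a * lo + b) / (c * lo + d)) ((a * hi + b) / (c * hi + d)) < z 0 ∧
          z 0 < max ((a * lo + b) / (c * lo + d)) ((a * hi + b) / (c * hi + d))) ∧
        1 ≤ z 1 ∧ z 1 ≤ v' (fun _ => z 0)} →
      (∀ z ∈ r.domain, r.integrand z =
        r'.integrand ![(a * z 0 + b) / (c * z 0 + d), z 1] * (|a * d - b * c| / (c * z 0 + d) ^ 2)) →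
      KZ.of r - KZ.of r' ∈ KZ.relations := by
  intro a b c d lo hi ha hb hc hd hlo hhi hlohi hD hpos v v' hvv' r r' hrd hr'd hint
  -- the open base interval is `ℚ`-semialgebraic and the denominator is positive on it
  have hσ : IsSemialgebraic ℚ {p : Fin 1 → ℝ | lo < p 0 ∧ p 0 < hi} :=
    (KZ.isSemialgebraic_setOf_const_lt_apply hlo 0).inter
      (KZ.isSemialgebraic_setOf_apply_lt_const hhi 0)
  have hden : ∀ p ∈ {p : Fin 1 → ℝ | lo < p 0 ∧ p 0 < hi}, 0 < c * p 0 + d :=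
    fun p hp => hpos (p 0) ⟨hp.1.le, hp.2.le⟩
  -- `Fin.init` of a point of the plane is the constant `1`-vector of its first coordinate
  have hinit : ∀ z : Fin 2 → ℝ, Fin.init z = fun _ : Fin 1 => z 0 := fun z => by
    funext i
    rw [Fin.fin_one_eq_zero i]
    rfl
  refine KZ.of_sub_of_mem_relations_covLift (σ := {p : Fin 1 → ℝ | lo < p 0 ∧ p 0 < hi})
    (Φ := fun y : Fin 1 → ℝ => fun _ : Fin 1 => (a * y 0 + b) / (c * y 0 + d))
    (Φ' := fun y => ((a * d - b * c) / (c * y 0 + d) ^ 2) • ContinuousLinearMap.id ℝ (Fin 1 → ℝ))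
    (moebiusCovLift_isSemialgebraicMapOn hσ ha hb hc hd fun p hp => (hden p hp).ne')
    (fun x hx => (hasFDerivAt_fin_one (fun t => (a * t + b) / (c * t + d)) _ x
      (moebiusCovLift_hasDerivAt a b c d (x 0) (hden x hx).ne')).hasFDerivWithinAt)
    (moebiusCovLift_injOn hD fun p hp => (hden p hp).ne') (fun x hx => hvv' x hx.1 hx.2) r r'
    ?_ ?_ fun z hz => ?_
  · -- the source band
    rw [hrd]
    ext z
    simp only [KZlog.mem_band, mem_setOf_eq, hinit]
    exact Iff.rfl
  · -- the target band, over the image interval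
    rw [hr'd, moebiusCovLift_image hlohi hD hpos]
    ext z
    simp only [KZlog.mem_band, mem_setOf_eq, hinit]
    exact Iff.rfl
  · -- the pull-back identity, Jacobian `|m′(z 0)| = |ad − bc|/(c z₀ + d)²`
    have hz' : lo < z 0 ∧ z 0 < hi := by
      rw [hrd] at hz
      exact hz.1
    have hz0 : 0 < c * z 0 + d := hpos (z 0) ⟨hz'.1.le, hz'.2.le⟩
    rw [hint z hz]
    simp only [hinit, moebiusCovLift_snoc_eq, det_smul_id_fin_one]
    rw [abs_div, abs_of_pos (pow_pos hz0 2)]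
    rfl

end Summit.KontsevichZagierPeriods.HyperbolicBloch.OffTetraSectorKernel

end
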